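import Mathlib
import HarnessLib
import Summits.ValiantsHypothesis.ValiantsHypothesis.Theorems.ValuativeGCTTailFlipBoundaryPaddingInvariance
import Summits.ValiantsHypothesis.ValiantsHypothesis.Theorems.ValuativeGCTValuativeFlipStableRay
import Summits.ValiantsHypothesis.ValiantsHypothesis.Theorems.ValuativeGCTValuativeFlipRayStabilityPlethysm
import Summits.ValiantsHypothesis.ValiantsHypothesis.Theorems.ValuativeGCTValuativeFlipTernaryFormsBorderDeterminantal
import Summits.ValiantsHypothesis.ValiantsHypothesis.Theorems.ValuativeGCTNoValuativeFlipBoundedLength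
import Literature.Computability.Complexity.OccurrenceObstructionsIPStability

/-!
# `ValuativeGCT.TailFlip` (stmt-ValiantsHypothesis-15687), line `boundary-ray-collapse`:
# constraints on witnesses of the residual stub `stub_topBoundaryFlip`

Helper file `--supports stmt-ValiantsHypothesis-15687` (lead a1 of the line).  The residual (registered
stub `stub_topBoundaryFlip`, skeleton `Cruxes/TailFlip/Lines/boundary_ray_collapse.lean`) asks, for each
window exponent `c` and all large `n`, for ONE datum: a padded base `n < m₀ ≤ n^k`, a degree `δ` and a
Kadish–Landsberg BOUNDARY shape `λ ⊢ m₀δ` (first row exactly `δ(m₀ - n)`, at most `n² + 1` parts) with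
`g(λ♯(m₀+j), (m₀+j)×δ, (m₀+j)×δ) < P_{n,m₀}(λ)` at the window top `m₀ + j = M = 2^((log₂ n + c)^c)`, where
`P_{n,m}(λ) = mult_{λ*} ℂ[Δ_m(X₀₀^{m-n} per_n)]` and `g` is the rectangular Kronecker coefficient.  This is a
multiplicity obstruction and is open.  This file records, as theorems over landed lemmas, what a witness
`(m₀, δ, λ)` of that strict inequality at a level `m₀ + j` MUST satisfy:

* `topBoundaryFlip_witness_body` — the body is LARGE: `n·δ > m₀ + j` (so at the window top `δ > M/n`,
  super-polynomial in `n`).  Stub-free chain: `P_{n,m₀}(λ) ≤ a_λ(δ[m₀])` (`orbitMultiplicity_le_plethysmCoeff`),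
  `≤ a_{λ♯}(δ[m₀+j])` (BIP lifting, `plethysmCoeff_le_plethysmCoeff_rowLift`), `≤ g(λ♯, □, □)` for body
  `≤ m₀ + j` (Ikenmeyer–Panova 2017 Prop. 2.8, `ikenmeyerPanova2017_prop_2_8_holds`); the body of a boundary
  shape of `(n, m₀)` is `|λ̄| = nδ` (`bodySize_of_boundary`) and is invariant under row lifts.
* `topBoundaryFlip_witness_length` — the shape is LONG: `ℓ(λ) ≥ 4` (bodies with at most two rows never
  witness; `orbitMultiplicity_paddedPer_le_det_of_card_parts_le_three` + BLMW Prop. 5.2.1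
  `orbitMultiplicity_det_le_kroneckerCoeff` + Kronecker ray monotonicity), and — through the lever of the
  line `boundaryPaddingInvariance` — `m₀ + j < 1 + n(n+1)^{max ℓ(λ) 1}` (bounded length never witnesses at
  the TOP level: `NoValuativeFlip.orbitMultiplicity_paddedPer_le_det_of_card_parts` at level `m₀ + j`), i.e.
  `ℓ(λ) > log_{n+1}((M-1)/n) → ∞` along the window.
* `topBoundaryFlip_witness_constraints` — the conjunction (registered sub-goal of the crux item).

These are the Lean forms of the constraints quoted in the skeleton docstring of `stub_topBoundaryFlip`
("body `nδ > M`", "`ℓ(λ) > log_{n+1}(M/n)`"); they do not decide the stub.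

Sources: Ikenmeyer–Panova, Adv. Math. 319 (2017) Prop. 2.8, Thm 2.1 (Manivel); Bürgisser–Ikenmeyer–Panova,
J. AMS 32 (2019) Lemma 5.2; BLMW, SIAM J. Comput. 40 (2011) Prop. 5.2.1; Kadish–Landsberg 2014 §2;
the landed no-flip ranges of this route (`…TwoRowNoFlip`, `…TernaryFormsBorderDeterminantal`,
`…NoValuativeFlipBoundedLength`).
-/

set_option linter.dupNamespace false

namespace Summit.ValiantsHypothesis.ValiantsHypothesis.Theorems.TailFlip

open MvPolynomial
open scoped BigOperators Matrix
open Literature.NumberTheory.DiophantineGeometry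
open Literature.Computability.AlgebraicComplexity
open Literature.Computability.Complexity
open Summit.ValiantsHypothesis.ValiantsHypothesis.Theorems.ValuativeFlip

noncomputable section

/-! ## Bookkeeping for boundary shapes -/

/-- The body of a boundary shape of `(n, m₀)` has `nδ` boxes: `|λ̄| = m₀δ - δ(m₀ - n) = nδ` (`n ≤ m₀`).
[Kadish–Landsberg 2014 §2; folklore] -/
theorem bodySize_of_boundary {n m₀ δ : ℕ} (hnm : n ≤ m₀) (lam : Nat.Partition (m₀ * δ))
    (hsup : lam.parts.sup = δ * (m₀ - n)) : bodySize lam = n * δ := by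
  unfold bodySize
  rw [hsup, Nat.mul_sub, Nat.mul_comm δ m₀, Nat.mul_comm δ n]
  have h : n * δ ≤ m₀ * δ := Nat.mul_le_mul_right δ hnm
  omega

/-- A shape with at most `n² + 1` parts at a base `m₀ > n` has at most `m₀²` parts. [folklore] -/
theorem card_parts_le_sq_of_lt {n m₀ D : ℕ} (hnm : n < m₀) (lam : Nat.Partition D)
    (hcard : lam.parts.card ≤ n * n + 1) : lam.parts.card ≤ m₀ * m₀ :=
  hcard.trans (by nlinarith)

/-! ## The body constraint (stub-free) -/

/-- **Small body: the base multiplicity is below the Kronecker coefficient up the ray.**  For `n ≤ m₀`,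
`λ ⊢ m₀δ` with at most `m₀²` parts and any padding `j` with `|λ̄| ≤ m₀ + j`:
`P_{n,m₀}(λ) ≤ g(λ♯(m₀+j), (m₀+j)×δ, (m₀+j)×δ)`.  Chain: `P ≤ a_λ(δ[m₀]) ≤ a_{λ♯}(δ[m₀+j]) ≤ g(λ♯)`
(`orbitMultiplicity_le_plethysmCoeff_holds`, `plethysmCoeff_le_plethysmCoeff_rowLift`,
`ikenmeyerPanova2017_prop_2_8_holds` with `bodySize_rowLift`).
[Ikenmeyer–Panova 2017 Prop. 2.8; Bürgisser–Ikenmeyer–Panova 2019 Lemma 5.2] -/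
theorem orbitMultiplicity_base_le_kroneckerCoeff_rowLift_of_bodySize_le {n m₀ δ : ℕ} [NeZero m₀]
    (hnm : n ≤ m₀) (lam : Nat.Partition (m₀ * δ)) (hlam : lam.parts.card ≤ m₀ * m₀) (j : ℕ)
    (hbody : bodySize lam ≤ m₀ + j) :
    orbitMultiplicity ℂ (paddedPerFormLex ℂ n m₀) m₀ (partitionWeightLex m₀ lam) ≤
      kroneckerCoeff ℂ (rowLift lam j) (Nat.Partition.rectangle (m₀ + j) δ)
        (Nat.Partition.rectangle (m₀ + j) δ) := by
  haveI : NeZero (m₀ + j) := ⟨by have := NeZero.ne m₀; omega⟩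
  have hcard : (rowLift lam j).parts.card ≤ (m₀ + j) * (m₀ + j) := card_parts_rowLift_le_sq lam hlam j
  have hbody' : bodySize (rowLift lam j) ≤ m₀ + j := by rw [bodySize_rowLift]; exact hbody
  calc orbitMultiplicity ℂ (paddedPerFormLex ℂ n m₀) m₀ (partitionWeightLex m₀ lam)
      ≤ plethysmCoeff ℂ (MatIdx m₀) m₀ (partitionWeightLex m₀ lam) :=
        orbitMultiplicity_le_plethysmCoeff_holds _ (NeZero.ne m₀) (paddedPerFormLex_isHomogeneous ℂ hnm) _
    _ ≤ plethysmCoeff ℂ (MatIdx (m₀ + j)) (m₀ + j) (partitionWeightLex (m₀ + j) (rowLift lam j)) :=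
        plethysmCoeff_le_plethysmCoeff_rowLift lam hlam j
    _ ≤ kroneckerCoeff ℂ (rowLift lam j) (Nat.Partition.rectangle (m₀ + j) δ)
          (Nat.Partition.rectangle (m₀ + j) δ) :=
        ikenmeyerPanova2017_prop_2_8_holds (m₀ + j) δ (rowLift lam j) hcard hbody'

/-- **Witnesses of the residual have LARGE body: `nδ > m₀ + j`.**  If a boundary shape `λ` of `(n, m₀)`
(`n < m₀`, at most `n² + 1` parts, `λ₁ = δ(m₀ - n)`) satisfies the residual's strict inequality at level
`m₀ + j` — `g(λ♯(m₀+j), □, □) < P_{n,m₀}(λ)` — then `m₀ + j < n·δ`.  At the window top `m₀ + j = M` this is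
`δ > M/n`: the degree of a witness is super-polynomial in `n`.
[Ikenmeyer–Panova 2017 Cor. of Prop. 2.8 ("degree lower bound"); new in this form] -/
theorem topBoundaryFlip_witness_body {n m₀ δ : ℕ} [NeZero m₀] (hnm : n < m₀)
    (lam : Nat.Partition (m₀ * δ)) (hcard : lam.parts.card ≤ n * n + 1)
    (hsup : lam.parts.sup = δ * (m₀ - n)) (j : ℕ)
    (hflip : kroneckerCoeff ℂ (rowLift lam j) (Nat.Partition.rectangle (m₀ + j) δ)
        (Nat.Partition.rectangle (m₀ + j) δ) <
      orbitMultiplicity ℂ (paddedPerFormLex ℂ n m₀) m₀ (partitionWeightLex m₀ lam)) :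
    m₀ + j < n * δ := by
  by_contra h
  have hbody : bodySize lam ≤ m₀ + j := by
    rw [bodySize_of_boundary hnm.le lam hsup]; omega
  exact absurd hflip (not_lt.mpr (orbitMultiplicity_base_le_kroneckerCoeff_rowLift_of_bodySize_le hnm.le
    lam (card_parts_le_sq_of_lt hnm lam hcard) j hbody))

/-! ## The length constraints -/

/-- **Short shapes never witness: `ℓ(λ) ≥ 4`.**  If `λ ⊢ m₀δ` has at most three parts (so its body has at
most two rows) then for every inner size `n ≤ m₀` and padding `j`,
`P_{n,m₀}(λ) ≤ K_{m₀}(λ*) ≤ g(λ, m₀×δ, m₀×δ) ≤ g(λ♯(m₀+j), □, □)` — ternary forms are border-determinantal,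
BLMW Prop. 5.2.1, and monotonicity of the Kronecker ray.
[BLMW 2011 Prop. 5.2.1; Manivel 2011 Thm 1; this route (`…TernaryFormsBorderDeterminantal`)] -/
theorem orbitMultiplicity_base_le_kroneckerCoeff_rowLift_of_card_parts_le_three {n m₀ δ : ℕ} [NeZero m₀]
    (hnm : n ≤ m₀) (lam : Nat.Partition (m₀ * δ)) (hlam : lam.parts.card ≤ m₀ * m₀)
    (h3 : lam.parts.card ≤ 3) (j : ℕ) :
    orbitMultiplicity ℂ (paddedPerFormLex ℂ n m₀) m₀ (partitionWeightLex m₀ lam) ≤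
      kroneckerCoeff ℂ (rowLift lam j) (Nat.Partition.rectangle (m₀ + j) δ)
        (Nat.Partition.rectangle (m₀ + j) δ) :=
  calc orbitMultiplicity ℂ (paddedPerFormLex ℂ n m₀) m₀ (partitionWeightLex m₀ lam)
      ≤ orbitMultiplicity ℂ (detFormLex ℂ m₀) m₀ (partitionWeightLex m₀ lam) :=
        orbitMultiplicity_paddedPer_le_det_of_card_parts_le_three hnm lam h3
    _ ≤ kroneckerCoeff ℂ lam (Nat.Partition.rectangle m₀ δ) (Nat.Partition.rectangle m₀ δ) :=
        orbitMultiplicity_det_le_kroneckerCoeff_holds (k := ℂ) lam hlam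
    _ ≤ kroneckerCoeff ℂ (rowLift lam j) (Nat.Partition.rectangle (m₀ + j) δ)
          (Nat.Partition.rectangle (m₀ + j) δ) :=
        kroneckerCoeff_le_kroneckerCoeff_rowLift lam j

/-- **Bounded length never witnesses at the TOP level** (through the lever of the line).  For a boundary
shape `λ` of `(n, m₀)` (`n < m₀`, at most `m₀²` parts, `λ₁ = δ(m₀ - n)`) and a padding `j` with
`1 + n(n+1)^{max ℓ(λ) 1} ≤ m₀ + j`:
`P_{n,m₀}(λ) ≤ P_{n,m₀+j}(λ♯) ≤ K_{m₀+j}((λ♯)*) ≤ g(λ♯, □, □)` (`boundaryPaddingInvariance`; the bounded-length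
no-flip range `NoValuativeFlip.orbitMultiplicity_paddedPer_le_det_of_card_parts` at level `m₀ + j`, where
`ℓ(λ♯) ≤ max ℓ(λ) 1`; BLMW Prop. 5.2.1).
[this line (`boundaryPaddingInvariance`); this route (`…NoValuativeFlipBoundedLength`); BLMW 2011 Prop. 5.2.1] -/
theorem orbitMultiplicity_base_le_kroneckerCoeff_rowLift_of_pow_le {n m₀ δ : ℕ} [NeZero m₀]
    (hnm : n < m₀) (lam : Nat.Partition (m₀ * δ)) (hlam : lam.parts.card ≤ m₀ * m₀)
    (hsup : lam.parts.sup = δ * (m₀ - n)) (j : ℕ)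
    (hpow : 1 + n * (n + 1) ^ (max lam.parts.card 1) ≤ m₀ + j) :
    orbitMultiplicity ℂ (paddedPerFormLex ℂ n m₀) m₀ (partitionWeightLex m₀ lam) ≤
      kroneckerCoeff ℂ (rowLift lam j) (Nat.Partition.rectangle (m₀ + j) δ)
        (Nat.Partition.rectangle (m₀ + j) δ) := by
  haveI : NeZero (m₀ + j) := ⟨by have := NeZero.ne m₀; omega⟩
  have hcard : (rowLift lam j).parts.card ≤ (m₀ + j) * (m₀ + j) := card_parts_rowLift_le_sq lam hlam j
  have hlen : (rowLift lam j).parts.card ≤ max lam.parts.card 1 := card_parts_rowLift_le lam j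
  have hpow' : 1 + n * (n + 1) ^ (rowLift lam j).parts.card ≤ m₀ + j :=
    le_trans (Nat.add_le_add_left (Nat.mul_le_mul_left n (Nat.pow_le_pow_right (Nat.succ_pos n) hlen)) 1) hpow
  calc orbitMultiplicity ℂ (paddedPerFormLex ℂ n m₀) m₀ (partitionWeightLex m₀ lam)
      ≤ orbitMultiplicity ℂ (paddedPerFormLex ℂ n (m₀ + j)) (m₀ + j) (partitionWeightLex (m₀ + j) (rowLift lam j)) :=
        boundaryPaddingInvariance n m₀ j δ hnm lam hlam hsup
    _ ≤ orbitMultiplicity ℂ (detFormLex ℂ (m₀ + j)) (m₀ + j) (partitionWeightLex (m₀ + j) (rowLift lam j)) :=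
        NoValuativeFlip.orbitMultiplicity_paddedPer_le_det_of_card_parts (rowLift lam j) hcard hpow'
    _ ≤ kroneckerCoeff ℂ (rowLift lam j) (Nat.Partition.rectangle (m₀ + j) δ)
          (Nat.Partition.rectangle (m₀ + j) δ) :=
        orbitMultiplicity_det_le_kroneckerCoeff_holds (k := ℂ) (rowLift lam j) hcard

/-- **Witnesses of the residual are LONG**: `ℓ(λ) ≥ 4` and `m₀ + j < 1 + n(n+1)^{max ℓ(λ) 1}` (so at the
window top `ℓ(λ) > log_{n+1}((M-1)/n)`, unbounded along the window). [new in this form] -/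
theorem topBoundaryFlip_witness_length {n m₀ δ : ℕ} [NeZero m₀] (hnm : n < m₀)
    (lam : Nat.Partition (m₀ * δ)) (hcard : lam.parts.card ≤ n * n + 1)
    (hsup : lam.parts.sup = δ * (m₀ - n)) (j : ℕ)
    (hflip : kroneckerCoeff ℂ (rowLift lam j) (Nat.Partition.rectangle (m₀ + j) δ)
        (Nat.Partition.rectangle (m₀ + j) δ) <
      orbitMultiplicity ℂ (paddedPerFormLex ℂ n m₀) m₀ (partitionWeightLex m₀ lam)) :
    3 < lam.parts.card ∧ m₀ + j < 1 + n * (n + 1) ^ (max lam.parts.card 1) := by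
  have hlam : lam.parts.card ≤ m₀ * m₀ := card_parts_le_sq_of_lt hnm lam hcard
  refine ⟨?_, ?_⟩
  · by_contra h
    exact absurd hflip (not_lt.mpr
      (orbitMultiplicity_base_le_kroneckerCoeff_rowLift_of_card_parts_le_three hnm.le lam hlam (not_lt.mp h) j))
  · by_contra h
    exact absurd hflip (not_lt.mpr
      (orbitMultiplicity_base_le_kroneckerCoeff_rowLift_of_pow_le hnm lam hlam hsup j (not_lt.mp h)))

/-! ## The conjunction (registered sub-goal) -/

/-- **Constraints on witnesses of `stub_topBoundaryFlip`** (registered sub-goal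
`topBoundaryFlip_witness_constraints` of the crux item).  A boundary datum `(m₀, δ, λ)` of inner size `n`
(`n < m₀`, `ℓ(λ) ≤ n² + 1`, `λ₁ = δ(m₀ - n)`) whose row-lift to level `m₀ + j` has rectangular Kronecker
coefficient below the padded-permanent multiplicity at the base satisfies: `m₀ + j < nδ` (large body,
`δ > (m₀+j)/n`), `3 < ℓ(λ)` (the body has at least three rows), and `m₀ + j < 1 + n(n+1)^{max ℓ(λ) 1}`
(length unbounded along the window). [new in this form] -/
theorem topBoundaryFlip_witness_constraints : ∀ (n m₀ δ j : ℕ) [NeZero m₀], n < m₀ → ∀ (lam : Nat.Partition (m₀ * δ)), lam.parts.card ≤ n * n + 1 → lam.parts.sup = δ * (m₀ - n) → kroneckerCoeff ℂ (rowLift lam j) (Nat.Partition.rectangle (m₀ + j) δ) (Nat.Partition.rectangle (m₀ + j) δ) < orbitMultiplicity ℂ (paddedPerFormLex ℂ n m₀) m₀ (partitionWeightLex m₀ lam) → m₀ + j < n * δ ∧ 3 < lam.parts.card ∧ m₀ + j < 1 + n * (n + 1) ^ (max lam.parts.card 1) := by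
  intro n m₀ δ j _ hnm lam hcard hsup hflip
  exact ⟨topBoundaryFlip_witness_body hnm lam hcard hsup j hflip,
    topBoundaryFlip_witness_length hnm lam hcard hsup j hflip⟩

end

end Summit.ValiantsHypothesis.ValiantsHypothesis.Theorems.TailFlip
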